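import Summits.ResolutionOfSingularities.ResolutionOfSingularities.Theorems.FrobeniusClosingPatchingRelPerfectConeTiltCharts
import Summits.ResolutionOfSingularities.ResolutionOfSingularities.Theorems.FrobeniusClosingPatchingRelPerfectConeDepthTwoLevelTwo
import HarnessLib

/-!
# Crux `PatchingRelPerfect` (stmt-ResolutionOfSingularities-16161), chain w52 — the first
# NON-GRADED member `(x₀x₁ + x₂² + x₂x₃²) + 𝔪⁴`: LEVEL TWO (the vertex blow-up), regularity

[OURS · L1 W5.2 · rung] Regularity half, level two, for the tilted cone member (identities:
`…ConeTiltCharts.lean`).  Same abstract setting as r2c's `…ConeDepthTwoLevelTwo.lean` (`A` a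
regular domain, `c = (t, v₀, v₁, v₂)` quasi-regular with `A/(c)` a regular domain, `A/(t)` a domain,
`v_k ∉ (t)`, `F = v₀v₁ + v₂² ∉ (t)`, the cone `V(t, F)` regular off its vertex); the residual is now
built from `F♯ = F + t v₂`, whose strict transform on the `v_k`-chart is the TILTED conic
`G♯ = G + u'e'₃`.  Since `G♯ ≡ G (mod u')`, every regularity input of r2c transfers along the ideal
equalities `(u', G♯) = (u', G)`, `(w, u', G♯) = (w, u', G)`:

* `isWeaklyRegular_w_u'_Gt`, `isRegularRing_quot_span_u'_Gt` — the strict transform `V(u', G♯)`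
  of the tilted cone surface is the SAME regular centre `V(u', G)`;
* `isRegular_of_isBlowup_LKt_succ` — the two-step Euclid tower along the quasi-regular pair
  `(u', G♯)` (`strictExc_isQuasiRegular_pair` with `r = F♯ ∉ (t)`);
* `isRegular_of_isBlowup_LKt_zero`, `isRegular_of_isBlowup_LKt_mul_span` — level-two assembly.

FORMAT evidence for the core only; nothing here is a statement of the manuscript under review.

## References

* The Stacks Project, Tags 080A, 080B, 0804, 07Z3, 0BIQ. [StacksProject]
* Q. Liu, *Algebraic Geometry and Arithmetic Curves*, OUP 2002, Thm. 8.1.19 (a). [Liu2002]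
* H. Matsumura, *Commutative Ring Theory*, CUP 1986, Thms. 14.2, 16.2, 16.3. [Matsumura1987]
-/

-- `Summit.<Summit>.<Sub>.Theorems` with `Sub = Summit` (single-conjunct summit, D-0017)
set_option linter.dupNamespace false

noncomputable section

open CategoryTheory CategoryTheory.Limits AlgebraicGeometry Literature.AlgebraicGeometry.Resolution
open IsLocalRing

namespace Summit.ResolutionOfSingularities.ResolutionOfSingularities.Theorems

namespace ConeRung

universe u

section LevelTwoRegular

variable {A : Type u} [CommRing A] (t : A) (v : Fin 3 → A)
  (hc : IsQuasiRegular (Fin.cons t v : Fin 4 → A))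

local notation3 "cc" => (Fin.cons t v : Fin 4 → A)
local notation3 "F" => v 0 * v 1 + v 2 ^ 2
local notation3 "Ft" => v 0 * v 1 + v 2 ^ 2 + t * v 2
local notation3 "LLt" => Ideal.span {v 0 * v 1 + v 2 ^ 2 + t * v 2} ⊔
  Ideal.span {t} * Ideal.span {t, v 0, v 1, v 2}
local notation3 "KKt" => Ideal.span {v 0 * v 1 + v 2 ^ 2 + t * v 2} ⊔ Ideal.span {t} ^ 2
local notation3 "w[" k "]" => chartBase cc (Fin.succ k) (cc (Fin.succ k))
local notation3 "u'[" k "]" => chartGen cc (Fin.succ k) 0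
local notation3 "G[" k "]" => chartGen cc (Fin.succ k) 1 * chartGen cc (Fin.succ k) 2 +
  chartGen cc (Fin.succ k) 3 ^ 2
local notation3 "Gt[" k "]" => chartGen cc (Fin.succ k) 1 * chartGen cc (Fin.succ k) 2 +
  chartGen cc (Fin.succ k) 3 ^ 2 + chartGen cc (Fin.succ k) 0 * chartGen cc (Fin.succ k) 3
local notation3 "c₃[" k "]" => (Fin.cons (chartBase cc (Fin.succ k) (cc (Fin.succ k)))
  (fun _ : Fin 1 => chartGen cc (Fin.succ k) 0) : Fin 2 → chartRing cc (Fin.succ k))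
local notation3 "xt'[" k "]" => (Fin.cons (chartGen cc (Fin.succ k) 0)
  (fun _ : Fin 1 => chartGen cc (Fin.succ k) 1 * chartGen cc (Fin.succ k) 2 +
    chartGen cc (Fin.succ k) 3 ^ 2 + chartGen cc (Fin.succ k) 0 * chartGen cc (Fin.succ k) 3) :
      Fin 2 → chartRing cc (Fin.succ k))

/-- `G♯ ≡ G` modulo `(w, u')`. [folklore] -/
theorem mk_Gt_eq (k : Fin 3) :
    Ideal.Quotient.mk (Ideal.span (Set.range c₃[k])) Gt[k] =
      Ideal.Quotient.mk (Ideal.span (Set.range c₃[k])) G[k] := by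
  rw [Ideal.Quotient.eq, show Gt[k] - G[k] = u'[k] * chartGen cc (Fin.succ k) 3 by ring]
  exact Ideal.mul_mem_right _ _ (Ideal.subset_span ⟨1, rfl⟩)

/-- `Ideal.ofList [w, u', G♯] = Ideal.ofList [w, u', G]`. [folklore] -/
theorem ofList_w_u'_Gt_eq (k : Fin 3) :
    Ideal.ofList [w[k], u'[k], Gt[k]] = Ideal.ofList [w[k], u'[k], G[k]] := by
  rw [Ideal.ofList_cons, Ideal.ofList_cons, Ideal.ofList_singleton, Ideal.ofList_cons,
    Ideal.ofList_cons, Ideal.ofList_singleton]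
  congr 1
  rw [← Ideal.span_insert, ← Ideal.span_insert, span_pair_tilt]

/-- `(xt') = (u', G♯) = (u', G)`. [folklore] -/
theorem span_range_xt'_eq (k : Fin 3) :
    Ideal.span (Set.range xt'[k]) = Ideal.span {u'[k], G[k]} := by
  rw [Fin.range_cons u'[k] (fun _ : Fin 1 => Gt[k]), Set.range_const, span_pair_tilt]

include hc in
/-- **`(w, u', G♯)` is a weakly regular sequence on the `v_k`-chart** (as `(w, u', G)`:
`G♯ ≡ G` modulo `(w, u')`). [cite: StacksProject, Tag 0BIQ] -/
theorem isWeaklyRegular_w_u'_Gt (k : Fin 3) [IsDomain (A ⧸ Ideal.span (Set.range cc))] :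
    RingTheory.Sequence.IsWeaklyRegular (chartRing cc (Fin.succ k)) [w[k], u'[k], Gt[k]] := by
  have h12 : RingTheory.Sequence.IsWeaklyRegular (chartRing cc (Fin.succ k)) [w[k], u'[k]] := by
    have h := CoreRungTower.isWeaklyRegular_chartFamily cc (Fin.succ k)
      (fun _ : Fin 1 => (⟨0, (Fin.succ_ne_zero k).symm⟩ : {l : Fin 4 // l ≠ Fin.succ k})) hc
      (Function.injective_of_subsingleton _)
    simpa [List.ofFn_succ] using h
  rw [show [w[k], u'[k], Gt[k]] = [w[k], u'[k]] ++ [Gt[k]] from rfl,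
    RingTheory.Sequence.isWeaklyRegular_append_iff]
  refine ⟨h12, ?_⟩
  rw [RingTheory.Sequence.isWeaklyRegular_singleton_iff]
  have hG := mk_G_mem_nonZeroDivisors t v hc k
  rw [← mk_Gt_eq] at hG
  have hsm := isSMulRegular_quotient_of_mem_nonZeroDivisors (Ideal.span (Set.range c₃[k])) Gt[k] hG
  have hK : (Ideal.ofList [w[k], u'[k]] • ⊤ :
      Submodule (chartRing cc (Fin.succ k)) (chartRing cc (Fin.succ k))) =
      Ideal.span (Set.range c₃[k]) := by
    rw [smul_eq_mul, Ideal.mul_top, ofList_w_u'_eq]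
  exact ((Submodule.quotEquivOfEq _ _ hK).isSMulRegular_congr _).mpr hsm

include hc in
/-- `C_j ⧸ (w, u', G♯)` is a regular ring (the same conic). [cite: Matsumura1987, Thm. 14.2] -/
theorem isRegularRing_quot_w_u'_Gt (k : Fin 3) [IsDomain (A ⧸ Ideal.span (Set.range cc))]
    [IsRegularRing (A ⧸ Ideal.span (Set.range cc))] :
    IsRegularRing (chartRing cc (Fin.succ k) ⧸ Ideal.ofList [w[k], u'[k], Gt[k]]) := by
  rw [ofList_w_u'_Gt_eq]
  exact isRegularRing_quot_w_u'_G t v hc k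

include hc in
/-- **The strict transform `V(u', G♯) = V(u', G)` of the tilted cone surface is a regular centre
on the `v_k`-chart.** [cite: Matsumura1987, Thm. 16.3] [cite: StacksProject, Tag 07Z3] -/
theorem isRegularRing_quot_span_u'_Gt (k : Fin 3) [IsRegularRing A]
    [IsDomain (A ⧸ Ideal.span (Set.range cc))] [IsRegularRing (A ⧸ Ideal.span (Set.range cc))]
    (hreg1 : ∀ (P : Ideal (A ⧸ Ideal.span {t, F})) [P.IsPrime],
      Ideal.Quotient.mk (Ideal.span {t, F}) (v k) ∉ P → IsRegularLocalRing (Localization.AtPrime P)) :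
    IsRegularRing (chartRing cc (Fin.succ k) ⧸ Ideal.span {u'[k], Gt[k]}) := by
  rw [span_pair_tilt]
  exact isRegularRing_quot_span_u'_G t v hc k hreg1

include hc in
/-- **The `v_k`-chart: every blow-up of `Spec C_j` along `(L K) C_j = w⁴ · (u', G♯) · ((G♯) + (u'²))`
is regular** — Stacks 080B twist and the two-step Euclid tower along the quasi-regular pair
`(u', G♯)` (`strictExc_isQuasiRegular_pair` with `r = F♯`). [cite: Liu2002, Thm. 8.1.19 (a)]
[cite: StacksProject, Tag 080A] -/
theorem isRegular_of_isBlowup_LKt_succ (k : Fin 3) [IsRegularRing A] [IsDomain A]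
    [IsDomain (A ⧸ Ideal.span (Set.range cc))] [IsRegularRing (A ⧸ Ideal.span (Set.range cc))]
    [IsDomain (A ⧸ Ideal.span {t})] (hvk : v k ∉ Ideal.span {t}) (hFt : F ∉ Ideal.span {t})
    (hreg1 : ∀ (P : Ideal (A ⧸ Ideal.span {t, F})) [P.IsPrime],
      Ideal.Quotient.mk (Ideal.span {t, F}) (v k) ∉ P → IsRegularLocalRing (Localization.AtPrime P))
    {Y : Scheme.{u}} {ρ : Y ⟶ Spec (.of (chartRing cc (Fin.succ k)))}
    (hρ : IsBlowup ρ (affineBlowup.idealSheaf ((LLt * KKt).map (chartBase cc (Fin.succ k))))) :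
    Scheme.IsRegular Y := by
  haveI : IsRegularRing (chartRing cc (Fin.succ k)) := isRegularRing_blowupChart cc (Fin.succ k) hc
  have hFtt : Ft ∉ Ideal.span {t} := fun h => hFt (by
    have h' := Ideal.sub_mem _ h (Ft_sub_mem_two t v)
    rwa [sub_sub_cancel] at h')
  have hx' : IsQuasiRegular xt'[k] :=
    strictExc_isQuasiRegular_pair t v k hc hvk (chartBase_Ft_two t v (Fin.succ k)) hFtt
  have hR' : IsRegularRing (chartRing cc (Fin.succ k) ⧸ Ideal.span (Set.range xt'[k])) := by
    rw [span_range_xt'_eq]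
    exact isRegularRing_quot_span_u'_G t v hc k hreg1
  have hw4 : w[k] ^ 4 ∈ nonZeroDivisors (chartRing cc (Fin.succ k)) :=
    pow_mem (reesChartBase_mem_nonZeroDivisors (cc (Fin.succ k))
      (Ideal.mem_span_range_self (f := cc) (x := Fin.succ k))) 4
  rw [map_chartBase_LKt_succ] at hρ
  exact CoreRungTower.isRegular_of_isBlowup_span_singleton_mul hw4 _
    (fun Y' ρ' h' => isRegular_of_isBlowup_tower 2 xt'[k] (fun _ : Fin 1 => (1 : Fin 2))
      (Function.injective_of_subsingleton _) hx' hR' h') hρ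

include hc in
/-- **The `t`-chart: every blow-up of `Spec C₀` along `(L K) C₀ = (w⁴)` is regular.**
[cite: Liu2002, Thm. 8.1.19 (a) (affine charts)] -/
theorem isRegular_of_isBlowup_LKt_zero [IsRegularRing A]
    [IsRegularRing (A ⧸ Ideal.span (Set.range cc))]
    {Y : Scheme.{u}} {ρ : Y ⟶ Spec (.of (chartRing cc 0))}
    (hρ : IsBlowup ρ (affineBlowup.idealSheaf ((LLt * KKt).map (chartBase cc 0)))) :
    Scheme.IsRegular Y := by
  haveI : IsRegularRing (chartRing cc 0) := isRegularRing_blowupChart cc 0 hc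
  rw [map_chartBase_LKt_zero] at hρ
  exact isRegular_of_isBlowup_idealSheaf_span_singleton_of_isRegularRing
    (pow_mem (reesChartBase_mem_nonZeroDivisors (cc 0)
      (Ideal.mem_span_range_self (f := cc) (x := 0))) 4) hρ

include hc in
/-- **LEVEL TWO: every blowing up of `Spec A` along `(L K) · (t, v₀, v₁, v₂)` is regular.**
[cite: StacksProject, Tag 080A] [cite: Liu2002, Thm. 8.1.19 (a)] -/
theorem isRegular_of_isBlowup_LKt_mul_span [IsRegularRing A] [IsDomain A]
    [IsDomain (A ⧸ Ideal.span (Set.range cc))] [IsRegularRing (A ⧸ Ideal.span (Set.range cc))]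
    [IsDomain (A ⧸ Ideal.span {t})] (hv : ∀ k, v k ∉ Ideal.span {t}) (hFt : F ∉ Ideal.span {t})
    (hreg1 : ∀ (k : Fin 3) (P : Ideal (A ⧸ Ideal.span {t, F})) [P.IsPrime],
      Ideal.Quotient.mk (Ideal.span {t, F}) (v k) ∉ P → IsRegularLocalRing (Localization.AtPrime P))
    {Y : Scheme.{u}} {f : Y ⟶ Spec (.of A)}
    (hf : IsBlowup f (affineBlowup.idealSheaf ((LLt * KKt) * Ideal.span {t, v 0, v 1, v 2}))) :
    Scheme.IsRegular Y := by
  nth_rw 2 [span_t_v_eq t v] at hf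
  exact isRegular_of_isBlowup_mul_of_charts cc _
    (fun j => Fin.cases
      (motive := fun j => ∀ (Y : Scheme.{u}) (ρ : Y ⟶ Spec (.of (chartRing cc j))),
        IsBlowup ρ (affineBlowup.idealSheaf ((LLt * KKt).map (chartBase cc j))) →
          Scheme.IsRegular Y)
      (fun _ _ h => isRegular_of_isBlowup_LKt_zero t v hc h)
      (fun k _ _ h => isRegular_of_isBlowup_LKt_succ t v hc k (hv k) hFt (hreg1 k) h) j) hf

end LevelTwoRegular

end ConeRung

end Summit.ResolutionOfSingularities.ResolutionOfSingularities.Theorems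

end
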